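import Summits.CriticalPhenomena.PercolationContinuityZ3.Theorems.PercNearOneGluingNoHeavyQuantLSCoreFlow
import HarnessLib

/-!
# QUANT lane R8, T-DEC, binder (II) `ConvClosedTResidue`: FLOW LEMMAS of the six-cell light-slice law, patterns LMG and LLG

builds on p205010 (kernel theorem, internal audit signed; external expert review pending)

Support file (`--supports stmt-CriticalPhenomena-4575`), QUANT lane seat prim-quant-census-1 (gen 22), rung R8 of
`run/shared/lean/prim/quant/LADDER.md`.  Memo `run/shared/lean/prim/quant/prim-quant-census-1/LSCORE-G22.md` §9.
Theorems only, standard axioms, no sorries.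

Companion of `…QuantLSCoreFlow` (`LawDec.lsLaw_decAtT_of_flow`, pattern MMG: row `m` = mid, mid, giant).  The six-cell light-slice law
`c₁δ_{p+l} + c₂δ_{p+l′} + c_Pδ_{p+h} + d₁δ_{m+l} + d₂δ_{m+l′} + d_Gδ_{m+h}` of the light credit pair `{p, m}` against the Type-I atom on
`{l, l′, h}` has, at span ratio `ω = (m−p)/(h−l′) ≤ 1`, two further patterns according to where the target `T` falls in row `m`:
LMG (`2(m+l) < T ≤ 2(m+l′)`: the cell `m+l` is a third low, `m+l′` and `p+h` are the mids) and LLG (`2(m+l′) < T`: both light cells of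
row `m` are lows, the head cell `p+h` is the only mid).  This file is the bookkeeping half of their DEC proofs: explicit flows from the
lows into the mids (each positive only on a compatible pair), remainders into the giant `m+h`, and the capacity inequalities (mid loads at
the `LawDec.usage` rates, giant load at `x/(1−x)`) give `DECAtT x T j M` (`decAtT_of_flowAtT`).  Coincident positions (`p+l′ = m+l`,
`p+h = m+l′`) are allowed.  The arithmetic half (pre-routing of the row-`m` lows into the head cell, then the two-low greedy of
`…QuantTwoLowGreedy` on the residual capacities) is for the companion files.

* `LawDec.lsLaw_decAtT_of_flow_LMG` — pattern LMG, nine flows.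
* `LawDec.lsLaw_decAtT_of_flow_LLG` — pattern LLG, eight flows.

[this work]; flow normal form `…QuantLawDecFlows` (typer g22).  Nothing here is cited as a published result.  The gluing rows served
[cite: KozmaNitzan2024, Conjecture 3 (p. 15)]; product measure [cite: Grimmett1999, §1.3 p. 10].
-/

noncomputable section

namespace Summit.CriticalPhenomena.PercolationContinuityZ3.Theorems

namespace Quant

open Finset

namespace LawDec

/-- Row selection by an indicator: `∑_{s ≤ j} [s = k]·g s = g k` for `k ≤ j`. [this work] -/
theorem sum_indicator_mul_eq (j k : ℕ) (g : ℕ → ℝ) (hk : k ≤ j) :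
    ∑ s ∈ Finset.range (j + 1), (if s = k then (1:ℝ) else 0) * g s = g k := by
  simp_rw [boole_mul]
  rw [Finset.sum_ite_eq' (Finset.range (j + 1)) k g, if_pos (Finset.mem_range.2 (by omega))]

/-- A flow term `F·[q = b]` from `s` vanishes when `F ≥ 0` may be positive only on a pair compatible with `T` and `q` is not
compatible. [this work] -/
theorem flow_term_eq_zero (T F : ℝ) (s b q : ℕ) (hF : 0 ≤ F) (hFc : 0 < F → T < (s : ℝ) + (b : ℝ))
    (hT : ¬ T < (s : ℝ) + (q : ℝ)) : F * (if q = b then (1:ℝ) else 0) = 0 := by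
  by_cases hqb : q = b
  · have hz : ¬ 0 < F := fun hp => hT (by rw [hqb]; exact hFc hp)
    rw [le_antisymm (not_lt.1 hz) hF, zero_mul]
  · rw [if_neg hqb, mul_zero]

/-- **DEC OF THE SIX-CELL LIGHT-SLICE LAW FROM ITS FLOW, PATTERN LMG.**  Floor `0 < x < 1`, target `T`, layer `j`, top `M`; positions
`p < m`, `l < l′ < h` with `2(p+l′) < T` and `2(m+l) < T` (three lows `p+l, p+l′, m+l`), `T ≤ 2(m+l′)`, `T ≤ 2(p+h)` (two mids, both
`≤ j`) and `j < m + h ≤ M` (the giant).  Masses `c₁, c₂, c_P, d₁, d₂, d_G` with sum `1` at `p+l, p+l′, p+h, m+l, m+l′, m+h`.  Flows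
`F₁P, F₁₂ ≥ 0` from `p+l` into `p+h, m+l′`, `F₂P, F₂₂ ≥ 0` from `p+l′`, `F₃P, F₃₂ ≥ 0` from `m+l`, each positive only when the pair is
compatible (`T < lo + hi`), with `F₁P + F₁₂ ≤ c₁`, `F₂P + F₂₂ ≤ c₂`, `F₃P + F₃₂ ≤ d₁` (the rests ride the giant).  If neither mid is
overloaded (`usage·F` sums `≤` its mass) and `x/(1−x)·(rests) ≤ d_G`, the law is `DECAtT x T j M`. [this work] -/
theorem lsLaw_decAtT_of_flow_LMG (x T c₁ c₂ cP d₁ d₂ dG F₁P F₁₂ F₂P F₂₂ F₃P F₃₂ : ℝ) (p m l l' h j M : ℕ)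
    (hx0 : 0 < x) (hx1 : x < 1)
    (hsum : c₁ + c₂ + cP + d₁ + d₂ + dG = 1)
    (hpm : p < m) (hll : l < l') (hlh : l' < h)
    (hlow : 2 * ((p : ℝ) + l') < T) (hlow1 : 2 * ((m : ℝ) + l) < T) (hmid2 : T ≤ 2 * ((m : ℝ) + l'))
    (hmidP : T ≤ 2 * ((p : ℝ) + h))
    (hPj : p + h ≤ j) (hm2j : m + l' ≤ j) (hGj : j < m + h) (hGM : m + h ≤ M)
    (hF1P : 0 ≤ F₁P) (hF12 : 0 ≤ F₁₂) (hF2P : 0 ≤ F₂P) (hF22 : 0 ≤ F₂₂) (hF3P : 0 ≤ F₃P) (hF32 : 0 ≤ F₃₂)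
    (hF1Pc : 0 < F₁P → T < ((p + l : ℕ) : ℝ) + ((p + h : ℕ) : ℝ)) (hF12c : 0 < F₁₂ → T < ((p + l : ℕ) : ℝ) + ((m + l' : ℕ) : ℝ))
    (hF2Pc : 0 < F₂P → T < ((p + l' : ℕ) : ℝ) + ((p + h : ℕ) : ℝ)) (hF22c : 0 < F₂₂ → T < ((p + l' : ℕ) : ℝ) + ((m + l' : ℕ) : ℝ))
    (hF3Pc : 0 < F₃P → T < ((m + l : ℕ) : ℝ) + ((p + h : ℕ) : ℝ)) (hF32c : 0 < F₃₂ → T < ((m + l : ℕ) : ℝ) + ((m + l' : ℕ) : ℝ))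
    (hR1 : F₁P + F₁₂ ≤ c₁) (hR2 : F₂P + F₂₂ ≤ c₂) (hR3 : F₃P + F₃₂ ≤ d₁)
    (hcapP : usage x T j (p + l) (p + h) * F₁P + usage x T j (p + l') (p + h) * F₂P + usage x T j (m + l) (p + h) * F₃P ≤ cP)
    (hcap2 : usage x T j (p + l) (m + l') * F₁₂ + usage x T j (p + l') (m + l') * F₂₂ + usage x T j (m + l) (m + l') * F₃₂ ≤ d₂)
    (hcapG : x / (1 - x) * ((c₁ - F₁P - F₁₂) + (c₂ - F₂P - F₂₂) + (d₁ - F₃P - F₃₂)) ≤ dG) :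
    DECAtT x T j M (fun q => c₁ * (if q = p + l then (1:ℝ) else 0) + c₂ * (if q = p + l' then (1:ℝ) else 0)
      + cP * (if q = p + h then (1:ℝ) else 0) + d₁ * (if q = m + l then (1:ℝ) else 0)
      + d₂ * (if q = m + l' then (1:ℝ) else 0) + dG * (if q = m + h then (1:ℝ) else 0)) := by
  classical
  -- the leftovers riding the giant
  set R₁ : ℝ := c₁ - F₁P - F₁₂ with hR₁
  set R₂ : ℝ := c₂ - F₂P - F₂₂ with hR₂
  set R₃ : ℝ := d₁ - F₃P - F₃₂ with hR₃
  have hR10 : 0 ≤ R₁ := by rw [hR₁]; linarith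
  have hR20 : 0 ≤ R₂ := by rw [hR₂]; linarith
  have hR30 : 0 ≤ R₃ := by rw [hR₃]; linarith
  -- names of the positions
  set a₁ : ℕ := p + l with ha₁
  set a₂ : ℕ := p + l' with ha₂
  set bP : ℕ := p + h with hbP
  set b₁ : ℕ := m + l with hb₁
  set b₂ : ℕ := m + l' with hb₂
  set bG : ℕ := m + h with hbG
  -- order facts (`a₂` and `b₁` may coincide or come in either order)
  have ha12 : a₁ < a₂ := by omega
  have ha1b1 : a₁ < b₁ := by omega
  have hb12 : b₁ < b₂ := by omega
  have hb2G : b₂ < bG := by omega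
  have hbPG : bP < bG := by omega
  have ha2P : a₂ < bP := by omega
  have hb1P : b₁ < bP := by
    have : 2 * ((m : ℝ) + l) < 2 * ((p : ℝ) + h) := lt_of_lt_of_le hlow1 hmidP
    have : (m : ℝ) + l < (p : ℝ) + h := by linarith
    exact_mod_cast (by exact_mod_cast this : m + l < p + h)
  have ha2b2 : a₂ < b₂ := by omega
  -- casts of positions
  have ca₁ : ((a₁ : ℕ) : ℝ) = (p : ℝ) + l := by rw [ha₁]; push_cast; ring
  have ca₂ : ((a₂ : ℕ) : ℝ) = (p : ℝ) + l' := by rw [ha₂]; push_cast; ring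
  have cbP : ((bP : ℕ) : ℝ) = (p : ℝ) + h := by rw [hbP]; push_cast; ring
  have cb₁ : ((b₁ : ℕ) : ℝ) = (m : ℝ) + l := by rw [hb₁]; push_cast; ring
  have cb₂ : ((b₂ : ℕ) : ℝ) = (m : ℝ) + l' := by rw [hb₂]; push_cast; ring
  have hll' : (l : ℝ) ≤ l' := by exact_mod_cast hll.le
  -- the three outgoing bundles and the flow
  set g₁ : ℕ → ℝ := fun q => F₁P * (if q = bP then (1:ℝ) else 0) + F₁₂ * (if q = b₂ then (1:ℝ) else 0)
    + R₁ * (if q = bG then (1:ℝ) else 0) with hg₁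
  set g₂ : ℕ → ℝ := fun q => F₂P * (if q = bP then (1:ℝ) else 0) + F₂₂ * (if q = b₂ then (1:ℝ) else 0)
    + R₂ * (if q = bG then (1:ℝ) else 0) with hg₂
  set g₃ : ℕ → ℝ := fun q => F₃P * (if q = bP then (1:ℝ) else 0) + F₃₂ * (if q = b₂ then (1:ℝ) else 0)
    + R₃ * (if q = bG then (1:ℝ) else 0) with hg₃
  set f : ℕ → ℕ → ℝ := fun s q =>
    (if s = a₁ then (1:ℝ) else 0) * g₁ q + (if s = a₂ then (1:ℝ) else 0) * g₂ q + (if s = b₁ then (1:ℝ) else 0) * g₃ q with hf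
  have ind_nn : ∀ (P : Prop) [Decidable P], (0:ℝ) ≤ (if P then (1:ℝ) else 0) := fun P _ => by split_ifs <;> norm_num
  have hg1n : ∀ q, 0 ≤ g₁ q := fun q => by
    have := ind_nn (q = bP); have := ind_nn (q = b₂); have := ind_nn (q = bG); simp only [hg₁]; positivity
  have hg2n : ∀ q, 0 ≤ g₂ q := fun q => by
    have := ind_nn (q = bP); have := ind_nn (q = b₂); have := ind_nn (q = bG); simp only [hg₂]; positivity
  have hg3n : ∀ q, 0 ≤ g₃ q := fun q => by
    have := ind_nn (q = bP); have := ind_nn (q = b₂); have := ind_nn (q = bG); simp only [hg₃]; positivity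
  -- the law vanishes above `M` and has mass `1`
  have hvan : ∀ q, M < q → c₁ * (if q = a₁ then (1:ℝ) else 0) + c₂ * (if q = a₂ then (1:ℝ) else 0)
      + cP * (if q = bP then (1:ℝ) else 0) + d₁ * (if q = b₁ then (1:ℝ) else 0)
      + d₂ * (if q = b₂ then (1:ℝ) else 0) + dG * (if q = bG then (1:ℝ) else 0) = 0 := by
    intro q hq
    rw [if_neg (by omega : q ≠ a₁), if_neg (by omega : q ≠ a₂), if_neg (by omega : q ≠ bP), if_neg (by omega : q ≠ b₁),
      if_neg (by omega : q ≠ b₂), if_neg (by omega : q ≠ bG)]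
    ring
  have hmass : ∑ q ∈ Finset.range (M + 1), (c₁ * (if q = a₁ then (1:ℝ) else 0) + c₂ * (if q = a₂ then (1:ℝ) else 0)
      + cP * (if q = bP then (1:ℝ) else 0) + d₁ * (if q = b₁ then (1:ℝ) else 0)
      + d₂ * (if q = b₂ then (1:ℝ) else 0) + dG * (if q = bG then (1:ℝ) else 0)) = 1 := by
    simp only [Finset.sum_add_distrib]
    rw [BlobDec2.sum_range_const_indicator _ a₁ (by omega), BlobDec2.sum_range_const_indicator _ a₂ (by omega),
      BlobDec2.sum_range_const_indicator _ bP (by omega), BlobDec2.sum_range_const_indicator _ b₁ (by omega),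
      BlobDec2.sum_range_const_indicator _ b₂ (by omega), BlobDec2.sum_range_const_indicator _ bG (by omega)]
    linarith
  refine decAtT_of_flowAtT x T j M _ hx0 hx1 hvan hmass ⟨f, ?_, ?_, ?_, ?_⟩
  · -- nonnegativity
    intro s q
    simp only [hf]
    have i1 := ind_nn (s = a₁); have i2 := ind_nn (s = a₂); have i3 := ind_nn (s = b₁)
    have := hg1n q; have := hg2n q; have := hg3n q
    positivity
  · -- support: only lows ship, only into compatible absorbers
    intro s q hpos
    simp only [hf] at hpos
    have hs : s = a₁ ∨ s = a₂ ∨ s = b₁ := by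
      by_contra hne
      push Not at hne
      rw [if_neg hne.1, if_neg hne.2.1, if_neg hne.2.2] at hpos
      simp at hpos
    have hslow : 2 * (s : ℝ) < T := by
      rcases hs with hs | hs | hs
      · rw [hs, ca₁]; linarith
      · rw [hs, ca₂]; exact hlow
      · rw [hs, cb₁]; exact hlow1
    have hsj : s ≤ j := by rcases hs with hs | hs | hs <;> omega
    have hq : q = bP ∨ q = b₂ ∨ q = bG := by
      by_contra hne
      push Not at hne
      have z : ∀ (F G H : ℝ), F * (if q = bP then (1:ℝ) else 0) + G * (if q = b₂ then (1:ℝ) else 0)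
          + H * (if q = bG then (1:ℝ) else 0) = 0 := by
        intro F G H; rw [if_neg hne.1, if_neg hne.2.1, if_neg hne.2.2]; ring
      simp only [hg₁, hg₂, hg₃, z, mul_zero, add_zero] at hpos
      exact lt_irrefl _ hpos
    have hqM' : q ≤ M := by rcases hq with hq | hq | hq <;> omega
    refine ⟨hsj, hslow, hqM', ?_⟩
    by_cases hqG : q = bG
    · exact Or.inl (by omega)
    · refine Or.inr ?_
      by_contra hT
      have zG : ∀ (R : ℝ), R * (if q = bG then (1:ℝ) else 0) = 0 := fun R => by rw [if_neg hqG, mul_zero]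
      have z1 : (if s = a₁ then (1:ℝ) else 0) * g₁ q = 0 := by
        by_cases h1 : s = a₁
        · simp only [hg₁]
          rw [flow_term_eq_zero T F₁P s bP q hF1P (fun hp => by rw [h1, ha₁, hbP]; exact hF1Pc hp) hT,
            flow_term_eq_zero T F₁₂ s b₂ q hF12 (fun hp => by rw [h1, ha₁, hb₂]; exact hF12c hp) hT, zG]; ring
        · rw [if_neg h1, zero_mul]
      have z2 : (if s = a₂ then (1:ℝ) else 0) * g₂ q = 0 := by
        by_cases h2 : s = a₂
        · simp only [hg₂]
          rw [flow_term_eq_zero T F₂P s bP q hF2P (fun hp => by rw [h2, ha₂, hbP]; exact hF2Pc hp) hT,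
            flow_term_eq_zero T F₂₂ s b₂ q hF22 (fun hp => by rw [h2, ha₂, hb₂]; exact hF22c hp) hT, zG]; ring
        · rw [if_neg h2, zero_mul]
      have z3 : (if s = b₁ then (1:ℝ) else 0) * g₃ q = 0 := by
        by_cases h3 : s = b₁
        · simp only [hg₃]
          rw [flow_term_eq_zero T F₃P s bP q hF3P (fun hp => by rw [h3, hb₁, hbP]; exact hF3Pc hp) hT,
            flow_term_eq_zero T F₃₂ s b₂ q hF32 (fun hp => by rw [h3, hb₁, hb₂]; exact hF32c hp) hT, zG]; ring
        · rw [if_neg h3, zero_mul]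
      rw [z1, z2, z3] at hpos
      simp at hpos
  · -- every low is shipped exactly
    intro s hsj hslow
    have hI : ∀ k, k ≤ M → ∑ q ∈ Finset.range (M + 1), (if q = k then (1:ℝ) else 0) = 1 := by
      intro k hk
      rw [Finset.sum_ite_eq' (Finset.range (M + 1)) k (fun _ => (1:ℝ)), if_pos (Finset.mem_range.2 (by omega))]
    have hS : ∀ (F G H : ℝ), ∑ q ∈ Finset.range (M + 1), (F * (if q = bP then (1:ℝ) else 0)
        + G * (if q = b₂ then (1:ℝ) else 0) + H * (if q = bG then (1:ℝ) else 0)) = F + G + H := by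
      intro F G H
      simp only [Finset.sum_add_distrib, ← Finset.mul_sum, hI bP (by omega), hI b₂ (by omega), hI bG (by omega), mul_one]
    have hsum : ∑ q ∈ Finset.range (M + 1), f s q =
        (if s = a₁ then (1:ℝ) else 0) * (F₁P + F₁₂ + R₁) + (if s = a₂ then (1:ℝ) else 0) * (F₂P + F₂₂ + R₂)
        + (if s = b₁ then (1:ℝ) else 0) * (F₃P + F₃₂ + R₃) := by
      simp only [hf, Finset.sum_add_distrib, ← Finset.mul_sum, hg₁, hg₂, hg₃, hS]
    rw [hsum]
    have hsP : s ≠ bP := by rintro rfl; rw [cbP] at hslow; linarith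
    have hs2' : s ≠ b₂ := by rintro rfl; rw [cb₂] at hslow; linarith
    have hsG : s ≠ bG := by omega
    dsimp only
    rw [if_neg hsP, if_neg hs2', if_neg hsG, hR₁, hR₂, hR₃]
    ring
  · -- no absorber is overloaded
    intro q hqM hself
    have hqa1 : q ≠ a₁ := by
      rintro rfl
      rcases hself with h1 | h1
      · omega
      · rw [ca₁] at h1; linarith
    have hqa2 : q ≠ a₂ := by
      rintro rfl
      rcases hself with h1 | h1
      · omega
      · rw [ca₂] at h1; linarith
    have hqb1 : q ≠ b₁ := by
      rintro rfl
      rcases hself with h1 | h1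
      · omega
      · rw [cb₁] at h1; linarith
    have e : ∀ s, usage x T j s q * f s q = (if s = a₁ then (1:ℝ) else 0) * (usage x T j s q * g₁ q)
        + (if s = a₂ then (1:ℝ) else 0) * (usage x T j s q * g₂ q) + (if s = b₁ then (1:ℝ) else 0) * (usage x T j s q * g₃ q) := by
      intro s; simp only [hf]; ring
    have hsumq : ∑ s ∈ Finset.range (j + 1), usage x T j s q * f s q
        = usage x T j a₁ q * g₁ q + usage x T j a₂ q * g₂ q + usage x T j b₁ q * g₃ q := by
      rw [Finset.sum_congr rfl (fun s _ => e s), Finset.sum_add_distrib, Finset.sum_add_distrib,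
        sum_indicator_mul_eq j a₁ (fun s => usage x T j s q * g₁ q) (by omega),
        sum_indicator_mul_eq j a₂ (fun s => usage x T j s q * g₂ q) (by omega),
        sum_indicator_mul_eq j b₁ (fun s => usage x T j s q * g₃ q) (by omega)]
    rw [hsumq]
    dsimp only
    rw [if_neg hqa1, if_neg hqa2, if_neg hqb1]
    simp only [hg₁, hg₂, hg₃]
    by_cases hqG : q = bG
    · -- the giant
      rw [if_pos hqG, if_neg (by omega : q ≠ bP), if_neg (by omega : q ≠ b₂)]
      simp only [mul_one, mul_zero, add_zero, zero_add]
      have hgq : j + 1 ≤ q := by omega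
      rw [usage_giant_eq x T j a₁ q hgq, usage_giant_eq x T j a₂ q hgq, usage_giant_eq x T j b₁ q hgq]
      have : x / (1 - x) * R₁ + x / (1 - x) * R₂ + x / (1 - x) * R₃ ≤ dG := by rw [← mul_add, ← mul_add]; exact hcapG
      linarith
    · rw [if_neg hqG]
      by_cases hqP : q = bP
      · rw [if_pos hqP]
        have hcP' : usage x T j a₁ q * F₁P + usage x T j a₂ q * F₂P + usage x T j b₁ q * F₃P ≤ cP := by rw [hqP]; exact hcapP
        by_cases hq2 : q = b₂
        · -- the head cell of row `p` together with `m + l′`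
          rw [if_pos hq2]
          simp only [mul_one, mul_zero, add_zero]
          have hc2' : usage x T j a₁ q * F₁₂ + usage x T j a₂ q * F₂₂ + usage x T j b₁ q * F₃₂ ≤ d₂ := by rw [hq2]; exact hcap2
          have e1 : usage x T j a₁ q * (F₁P + F₁₂) + usage x T j a₂ q * (F₂P + F₂₂) + usage x T j b₁ q * (F₃P + F₃₂)
              = (usage x T j a₁ q * F₁P + usage x T j a₂ q * F₂P + usage x T j b₁ q * F₃P)
                + (usage x T j a₁ q * F₁₂ + usage x T j a₂ q * F₂₂ + usage x T j b₁ q * F₃₂) := by ring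
          rw [e1]
          linarith
        · rw [if_neg hq2]
          simp only [mul_one, mul_zero, add_zero]
          linarith
      · rw [if_neg hqP]
        by_cases hq2 : q = b₂
        · rw [if_pos hq2]
          simp only [mul_one, mul_zero, add_zero, zero_add]
          have hc2' : usage x T j a₁ q * F₁₂ + usage x T j a₂ q * F₂₂ + usage x T j b₁ q * F₃₂ ≤ d₂ := by rw [hq2]; exact hcap2
          linarith
        · rw [if_neg hq2]
          simp only [mul_zero, add_zero]
          rfl

end LawDec

end Quant

end Summit.CriticalPhenomena.PercolationContinuityZ3.Theorems
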